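import Mathlib.LinearAlgebra.Matrix.SchurComplement
import Mathlib.LinearAlgebra.Matrix.Notation
import Mathlib.Algebra.MvPolynomial.CommRing
import Mathlib.Data.Nat.Log
import Literature.Computability.AlgebraicComplexity.VPDeterminantalQP
import Literature.Computability.AlgebraicComplexity.DeterminantalComplexityProofs
import Literature.Computability.AlgebraicComplexity.DepthReductionProofs
import HarnessLib

/-!
# `VP` families have quasi-polynomially bounded determinantal complexity — discharge

Discharge (D-0014) of the named fact
`Literature.Computability.AlgebraicComplexity.isQPBounded_determinantalComplexity_of_isVPFamily` (`VPDeterminantalQP.lean`;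
Bürgisser–Clausen–Shokrollahi 1997, Cor. (21.40) with Thm. (21.27), Thm. (21.33) and
Thm. (21.36)): `theorem Literature.CplxAlg.isQPBounded_determinantalComplexity_of_isVPFamily_holds`,
proved over every commutative ring of coefficients (the fact asks for a field).

## The printed proof (BCS 1997, §21.3 and §21.5, pp. 553–555 and 562–569) and its transcription

BCS prove `VQP_e = VQP` (Thm. (21.33)) from the theorem of Hyafil and
Valiant–Skyum–Berkowitz–Rackoff (Thm. (21.36): `D(f) ≤ c(log(d L(f)) log d + log n)`) and
Brent's `D = Θ(log E)` (Thm. (21.35)), and then (Cor. (21.40), "DET is VQP-complete") apply the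
universality of the determinant (Thm. (21.27): expression size `u` ⟹ `f` is a projection of
`DET_{2u+2}`), so that `dc(fₙ) ≤ 2 E(fₙ) + 2` is qp-bounded (Def. (21.31)) for `f ∈ VP ⊆ VQP`.
The heart of the proof of Thm. (21.36) is the matrix `B = (b_{ij})` of *gate quotients* of a
homogeneous straight-line program (properties (C), (D)), the antichains `Γ_b(a)` and the
identities (E) `b_{ij} = Σ_{t ∈ Γ_b(a)} b_{it} b_{tj}`, `b_j = Σ_{t ∈ Γ_b(a)} b_t b_{tj}`, and the
STAGES of (F): stage `δ + 1` obtains every `b_j`, `b_{ij}` of degree in `(2^δ, 2^{δ+1}]` as a sum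
of at most `r` products of three polynomials of degree `≤ 2^δ` obtained at earlier stages
((G), (H)); stage `0` consists of linear forms. The proof of Thm. (21.27) maps an expression `φ`
to a matrix `μ(φ) = [[α, 0], [A, β]]` with `A` upper triangular with ones on the diagonal, a row
`α` and a column `β`; products become block triangular matrices (Case 2) and sums the "parallel"
block matrices of Lemma (21.28).

In the tree the combinatorial core of Thm. (21.36) is already available, sorry-free, in
`GateQuotients.lean` (written for Tavenas' depth reduction): `DepthReduction.HomCircuit.quot` is
the gate quotient, `frontier m` is `Γ_b(m)`, `val_eq_sum_frontier` / `quot_eq_sum_frontier` are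
the identities (E), and `expandAtom` is one stage of (G)/(H) in the `×`-balanced form of
Agrawal–Vinay/Tavenas: an atom (`[ν]` or `[ν : μ]`) of formal degree `D ≥ 2` is a sum of at most
`#ι²` products of at most `5` atoms of formal degree `≤ D / 2` (`expandAtom_sum`,
`expandAtom_half`, `expandAtom_length_le`, `length_expandAtom_le`), while atoms of formal degree
`≤ 1` have affine values (`totalDegree_aval_le`). Homogenization of a straight-line program of
length `L` cut at degree `d` is `SLP.homogenize d`, on `≤ 4L(d+1)²` nodes (`SLP.card_node_le`;
BCS Lemma (21.25) has `(d+1)² L`).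

Instead of realising the stages as a small-depth program, converting it to a formula (Brent) and
the formula to a determinant (Thm. (21.27)), this file composes the determinant *along* the stage
recursion, with the matrices of the proof of Thm. (21.27) / Lemma (21.28) read through the Schur
complement of their unipotent block:

* Part 1, `HasInvRepr g m`: there are a square matrix `B` of affine linear forms with
  `det B = 1`, of size at most `m`, and constant vectors `v`, `w` with `g = vᵀ B⁻¹ w` (the shape
  `[[α, 0], [A, β]]` of (21.27)(C), `α = vᵀ`, `β = w`; in the language of algebraic branching
  programs `B = 1 - (adjacency matrix)` and `(B⁻¹)_{st}` is the sum over source–sink paths of the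
  products of the edge labels). Affine forms have size `2` (`HasInvRepr.of_totalDegree_le_one`,
  (21.27) Case 1), sums and products have *additive* size (`HasInvRepr.add`: block diagonal,
  Lemma (21.28); `HasInvRepr.mul`: block upper triangular with the constant off-diagonal block
  `-w₁ v₂ᵀ`, (21.27) Case 2), and `HasInvRepr g m → HasDetRepr g (m + 1)`
  (`HasInvRepr.hasDetRepr`: the bordered matrix `[[B, -w], [vᵀ, 0]]` has determinant `vᵀ B⁻¹ w`
  by `Matrix.det_fromBlocks₁₁`), whence `dc g ≤ m + 1`.
* Part 2, the stage recursion `HomCircuit.hasInvRepr_aval`: an atom of formal degree `≤ 2^j` has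
  an inverse read-out of size `≤ invReprBound (#ι²) j`, where `invReprBound N 0 = 2` and
  `invReprBound N (j+1) = N (5 b_j + 2)`; `invReprBound (2^F) j ≤ 2^{(F+4) j + 1}`.
  `SLP.hasInvRepr_val`: a value of total degree `≤ d` of a straight-line program of length `L`
  has an inverse read-out of size `≤ (d+1) · invReprBound (S²) (log₂ d + 1)`, `S = 4L(d+1)²`
  (sum of its `d + 1` homogeneous components).
* Part 3, the bound: `determinantalComplexity_le_two_pow` (`deg g ≤ d < 2^E`, `L(g) ≤ 2^E` ⟹
  `dc g ≤ 2^{17 E²}`, i.e. `2^{O(log²(dL))}`, the printed `2^{O(log(dL) log d)}` up to the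
  constant) and the discharge: for a `VP` family `deg fₙ, L(fₙ) < 2^{(log₂ n + 1)A}`
  (`IsPBounded.exists_lt_two_pow`), so `dc(fₙ) ≤ 2^{17 A² (log₂ n + 1)²} ≤ 2^{(log₂ n + c)^c}` with
  `c = 17A² + 3` (`IsQPBounded`, the tree's form of BCS Def. (21.31)).

Circuit plumbing (`ArithCircuit` → straight-line program) is `DepthReduction.exists_slp` and
`ArithCircuit.exists_computes_size_eq_complexity` (`DepthReductionProofs.lean`,
`ArithCircuitProofs.lean`); `complexity` is BCS's `L` up to a factor `≤ 3`, invisible here.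

## Design notes

* Only `det B = 1` is recorded in `HasInvRepr`, not unipotency/triangularity of `B` (BCS keep
  `A` unit upper triangular): the determinant condition is what the block formulas
  (`Matrix.det_fromBlocks_zero₂₁`, `Matrix.inv_fromBlocks_zero₂₁_of_isUnit_iff`,
  `Matrix.det_fromBlocks₁₁`) need, and it is preserved by both compositions.
* The index type of `B` is an arbitrary `Fintype` of cardinality `≤ m` (monotonicity in `m` is
  free; sums/products live on `ι₁ ⊕ ι₂`); the passage to `Fin m` happens once, in
  `HasInvRepr.hasDetRepr`, via `Fintype.equivFin` and the padding lemma `HasDetRepr.mono_holds`.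
* Read-out vectors are constants (`v w : ι → k`, used through `C`), so that the off-diagonal
  block of the product construction is again affine.
* Everything is proved over a commutative ring `k`; the fact is the instance `Field k`.

## References

* P. Bürgisser, M. Clausen, M. A. Shokrollahi, *Algebraic Complexity Theory*, Springer 1997
  [BurgisserClausenShokrollahi1997], §21.3 Thm. (21.27), Lemma (21.28) (pp. 553–555); §21.5
  Def. (21.31), Thm. (21.33), Thm. (21.35), Thm. (21.36) with its proof (C)–(H), Cor. (21.40)
  (pp. 562–569; PDF pp. 582–584 and 591–598 of the held scan, page-checked 2026-08-14).
* L. G. Valiant, S. Skyum, S. Berkowitz, C. Rackoff, *Fast parallel computation of polynomials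
  using few processors*, SIAM J. Comput. 12 (1983) 641–644 [ValiantSkyumBerkowitzRackoff1983].
* L. G. Valiant, *Completeness classes in algebra*, STOC 1979, Thm. 1 and §2 [ValiantSTOC1979].
* T. Mignon, N. Ressayre, *A quadratic bound for the determinant and permanent problem*,
  IMRN 2004, §1 (affine determinantal representations) [MignonRessayre2004].
* S. Tavenas, *Improved bounds for reduction to depth 4 and depth 3*, Inform. and Comput. 240
  (2015), §4–§5 [Tavenas2015] (the `×`-balanced expansion used in `GateQuotients.lean`).
-/

noncomputable section

open MvPolynomial Matrix

namespace Literature.Computability.AlgebraicComplexity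

universe u v w

/-! ## Part 1. Inverse read-outs `vᵀ B⁻¹ w` (BCS 1997, Thm. (21.27), Lemma (21.28)) -/

section InvRepr

variable {k : Type u} [CommRing k] {σ : Type v}

/-- `HasInvRepr g m`: the polynomial `g` is a constant bilinear read-out of the inverse of an
affine matrix of determinant one and size at most `m`, i.e. there are a finite index type `ι`
with `#ι ≤ m`, a matrix `B : ι × ι → k[X]` all of whose entries have total degree `≤ 1`, with
`det B = 1`, and constant vectors `v w : ι → k` such that `g = ∑ᵢⱼ v i · (B⁻¹) i j · w j`.
This is the shape `[[α, 0], [A, β]]` (`A` unipotent, `α = vᵀ`, `β = w`) of the matrices in the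
proof of Bürgisser–Clausen–Shokrollahi 1997, Thm. (21.27), read through the Schur complement
(`HasInvRepr.hasDetRepr`); equivalently, an algebraic branching program with adjacency matrix
`1 - B`. [cite: BurgisserClausenShokrollahi1997, Thm. (21.27) (proof, property (C)), p. 554] -/
def HasInvRepr (g : MvPolynomial σ k) (m : ℕ) : Prop :=
  ∃ (ι : Type) (_ : Fintype ι) (_ : DecidableEq ι) (B : Matrix ι ι (MvPolynomial σ k))
    (v w : ι → k), Fintype.card ι ≤ m ∧ (∀ i j, (B i j).totalDegree ≤ 1) ∧ B.det = 1 ∧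
      (fun i => C (v i)) ⬝ᵥ (B⁻¹ *ᵥ fun j => C (w j)) = g

namespace HasInvRepr

/-- Monotonicity in the size bound (the bound `#ι ≤ m` is part of the definition). [folklore] -/
theorem mono {g : MvPolynomial σ k} {m m' : ℕ} (h : HasInvRepr g m) (hm : m ≤ m') :
    HasInvRepr g m' := by
  obtain ⟨ι, _, _, B, v, w, hc, hB, hd, hg⟩ := h
  exact ⟨ι, inferInstance, inferInstance, B, v, w, hc.trans hm, hB, hd, hg⟩

/-- The zero polynomial has the empty representation (size `0`). [folklore] -/
theorem zero : HasInvRepr (0 : MvPolynomial σ k) 0 :=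
  ⟨PEmpty, inferInstance, inferInstance, Matrix.of fun _ _ => 0, fun _ => 0, fun _ => 0, by simp,
    fun i => i.elim, Matrix.det_isEmpty, by simp [dotProduct]⟩

/-- An affine linear form `a` (total degree `≤ 1`) is read out of the `2 × 2` unipotent matrix
`[[1, -a], [0, 1]]`, whose inverse is `[[1, a], [0, 1]]` (BCS 1997, proof of Thm. (21.27), Case 1:
atoms get `2 × 2` matrices).
[cite: BurgisserClausenShokrollahi1997, Thm. (21.27) (proof, Case 1), p. 555] -/
theorem of_totalDegree_le_one {a : MvPolynomial σ k} (ha : a.totalDegree ≤ 1) :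
    HasInvRepr a 2 := by
  refine ⟨Fin 2, inferInstance, inferInstance, !![1, -a; 0, 1], ![1, 0], ![0, 1], by simp,
    ?_, ?_, ?_⟩
  · intro i j
    fin_cases i <;> fin_cases j <;> simp [totalDegree_neg, ha]
  · rw [Matrix.det_fin_two_of]
    ring
  · have hinv : (!![1, -a; 0, 1] : Matrix (Fin 2) (Fin 2) (MvPolynomial σ k))⁻¹ =
        !![1, a; 0, 1] := by
      apply Matrix.inv_eq_right_inv
      rw [Matrix.mul_fin_two, Matrix.one_fin_two]
      simp
    rw [hinv]
    simp [Matrix.mulVec, dotProduct, Fin.sum_univ_two]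

/-- A matrix of determinant `1` is a unit. [folklore] -/
theorem isUnit_of_det_eq_one {ι : Type*} [Fintype ι] [DecidableEq ι]
    {B : Matrix ι ι (MvPolynomial σ k)} (hd : B.det = 1) : IsUnit B :=
  (Matrix.isUnit_iff_isUnit_det B).2 (hd ▸ isUnit_one)

/-- **Sums** (BCS 1997, Lemma (21.28): the "parallel" block matrix; here simply block diagonal,
with concatenated read-out vectors): `HasInvRepr g₁ m₁ → HasInvRepr g₂ m₂ →
HasInvRepr (g₁ + g₂) (m₁ + m₂)`, since `(B₁ ⊕ B₂)⁻¹ = B₁⁻¹ ⊕ B₂⁻¹` and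
`(v₁, v₂)ᵀ (B₁⁻¹ ⊕ B₂⁻¹) (w₁, w₂) = v₁ᵀ B₁⁻¹ w₁ + v₂ᵀ B₂⁻¹ w₂`.
[cite: BurgisserClausenShokrollahi1997, Lemma (21.28), p. 554] -/
theorem add {g₁ g₂ : MvPolynomial σ k} {m₁ m₂ : ℕ} (h₁ : HasInvRepr g₁ m₁)
    (h₂ : HasInvRepr g₂ m₂) : HasInvRepr (g₁ + g₂) (m₁ + m₂) := by
  obtain ⟨ι₁, _, _, B₁, v₁, w₁, hc₁, hB₁, hd₁, hg₁⟩ := h₁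
  obtain ⟨ι₂, _, _, B₂, v₂, w₂, hc₂, hB₂, hd₂, hg₂⟩ := h₂
  refine ⟨ι₁ ⊕ ι₂, inferInstance, inferInstance, Matrix.fromBlocks B₁ 0 0 B₂, Sum.elim v₁ v₂,
    Sum.elim w₁ w₂, ?_, ?_, ?_, ?_⟩
  · rw [Fintype.card_sum]
    exact Nat.add_le_add hc₁ hc₂
  · rintro (i | i) (j | j)
    · simpa using hB₁ i j
    · simp
    · simp
    · simpa using hB₂ i j
  · rw [Matrix.det_fromBlocks_zero₂₁, hd₁, hd₂, mul_one]
  · rw [Matrix.inv_fromBlocks_zero₂₁_of_isUnit_iff _ _ _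
      (iff_of_true (isUnit_of_det_eq_one hd₁) (isUnit_of_det_eq_one hd₂)),
      Matrix.mul_zero, Matrix.zero_mul, neg_zero, Matrix.fromBlocks_mulVec]
    have hv : (fun i => (C (Sum.elim v₁ v₂ i) : MvPolynomial σ k)) =
        Sum.elim (fun i => C (v₁ i)) (fun i => C (v₂ i)) := by
      funext i; cases i <;> rfl
    rw [hv, sumElim_dotProduct_sumElim, Matrix.zero_mulVec, Matrix.zero_mulVec, add_zero,
      zero_add, ← hg₁, ← hg₂]
    rfl

/-- **Products** (BCS 1997, proof of Thm. (21.27), Case 2: block triangular matrix): with the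
constant off-diagonal block `Q = -w₁ v₂ᵀ`,
`[[B₁, Q], [0, B₂]]⁻¹ = [[B₁⁻¹, B₁⁻¹ w₁ v₂ᵀ B₂⁻¹], [0, B₂⁻¹]]`, so reading out with `(v₁, 0)` and
`(0, w₂)` gives `(v₁ᵀ B₁⁻¹ w₁) (v₂ᵀ B₂⁻¹ w₂) = g₁ g₂`; sizes add.
[cite: BurgisserClausenShokrollahi1997, Thm. (21.27) (proof, Case 2), p. 555] -/
theorem mul {g₁ g₂ : MvPolynomial σ k} {m₁ m₂ : ℕ} (h₁ : HasInvRepr g₁ m₁)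
    (h₂ : HasInvRepr g₂ m₂) : HasInvRepr (g₁ * g₂) (m₁ + m₂) := by
  obtain ⟨ι₁, _, _, B₁, v₁, w₁, hc₁, hB₁, hd₁, hg₁⟩ := h₁
  obtain ⟨ι₂, _, _, B₂, v₂, w₂, hc₂, hB₂, hd₂, hg₂⟩ := h₂
  -- the constant connecting block `-(w₁ v₂ᵀ)`
  let W : Matrix ι₁ ι₂ (MvPolynomial σ k) :=
    Matrix.vecMulVec (fun i => C (w₁ i)) (fun j => C (v₂ j))
  refine ⟨ι₁ ⊕ ι₂, inferInstance, inferInstance, Matrix.fromBlocks B₁ (-W) 0 B₂,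
    Sum.elim v₁ 0, Sum.elim 0 w₂, ?_, ?_, ?_, ?_⟩
  · rw [Fintype.card_sum]
    exact Nat.add_le_add hc₁ hc₂
  · rintro (i | i) (j | j)
    · simpa using hB₁ i j
    · simp only [Matrix.fromBlocks_apply₁₂, Matrix.neg_apply, totalDegree_neg, W,
        Matrix.vecMulVec_apply, ← C_mul, totalDegree_C]
      exact Nat.zero_le _
    · simp
    · simpa using hB₂ i j
  · rw [Matrix.det_fromBlocks_zero₂₁, hd₁, hd₂, mul_one]
  · rw [Matrix.inv_fromBlocks_zero₂₁_of_isUnit_iff _ _ _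
      (iff_of_true (isUnit_of_det_eq_one hd₁) (isUnit_of_det_eq_one hd₂)),
      Matrix.fromBlocks_mulVec]
    have hv : (fun i => (C (Sum.elim v₁ (0 : ι₂ → k) i) : MvPolynomial σ k)) =
        Sum.elim (fun i => C (v₁ i)) 0 := by
      funext i; cases i <;> simp
    have hw₁ : ((fun j => (C (Sum.elim (0 : ι₁ → k) w₂ j) : MvPolynomial σ k)) ∘ Sum.inl) =
        0 := by
      funext i; simp
    have hw₂ : ((fun j => (C (Sum.elim (0 : ι₁ → k) w₂ j) : MvPolynomial σ k)) ∘ Sum.inr) =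
        fun j => C (w₂ j) := by
      funext i; simp
    rw [hv, hw₁, hw₂, sumElim_dotProduct_sumElim, zero_dotProduct, add_zero, Matrix.mulVec_zero,
      zero_add, Matrix.mul_neg, Matrix.neg_mul, neg_neg, ← Matrix.mulVec_mulVec,
      ← Matrix.mulVec_mulVec, Matrix.vecMulVec_mulVec, Matrix.mulVec_smul, dotProduct_smul, hg₁,
      MulOpposite.smul_eq_mul_unop, MulOpposite.unop_op, hg₂]

/-- **From inverse read-outs to determinants** (the Schur complement behind BCS 1997,
Thm. (21.27): `val(φ) = det μ(φ)`): if `g = vᵀ B⁻¹ w` with `det B = 1`, then the bordered matrix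
`[[B, -w], [vᵀ, 0]]` — affine entries, one more row and column — has determinant
`det B · (0 - vᵀ B⁻¹ (-w)) = g` (`Matrix.det_fromBlocks₁₁`). Hence `HasDetRepr g (m + 1)`
(reindex along `Fintype.equivFin`, pad with `HasDetRepr.mono_holds`).
[cite: BurgisserClausenShokrollahi1997, Thm. (21.27) (proof, properties (A)–(C)), pp. 554–555] -/
theorem hasDetRepr {g : MvPolynomial σ k} {m : ℕ} (h : HasInvRepr g m) :
    HasDetRepr g (m + 1) := by
  obtain ⟨ι, _, _, B, v, w, hc, hB, hd, hg⟩ := h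
  -- the bordered matrix on `ι ⊕ Unit`
  let M : Matrix (ι ⊕ Unit) (ι ⊕ Unit) (MvPolynomial σ k) :=
    Matrix.fromBlocks B (-Matrix.replicateCol Unit fun i => C (w i))
      (Matrix.replicateRow Unit fun j => C (v j)) 0
  have hMdeg : ∀ p q, (M p q).totalDegree ≤ 1 := by
    rintro (p | p) (q | q)
    · simpa [M] using hB p q
    · simp [M, totalDegree_neg]
    · simp [M]
    · simp [M]
  have hMdet : M.det = g := by
    letI : Invertible B := Matrix.invertibleOfIsUnitDet B (hd ▸ isUnit_one)
    rw [Matrix.det_fromBlocks₁₁, hd, one_mul, Matrix.mul_neg, sub_neg_eq_add, zero_add,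
      Matrix.mul_assoc, ← Matrix.replicateCol_mulVec, Matrix.replicateRow_mul_replicateCol,
      Matrix.det_unique, Matrix.of_apply, Matrix.invOf_eq_nonsing_inv, hg]
  -- reindex to `Fin (#ι + 1)` and pad to `m + 1`
  have hrepr : HasDetRepr g (Fintype.card (ι ⊕ Unit)) := by
    refine ⟨Matrix.reindex (Fintype.equivFin _) (Fintype.equivFin _) M, fun i j => ?_, ?_⟩
    · rw [Matrix.reindex_apply, Matrix.submatrix_apply]
      exact hMdeg _ _
    · rw [Matrix.det_reindex_self, hMdet]
  refine HasDetRepr.mono_holds hrepr ?_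
  rw [Fintype.card_sum, Fintype.card_unit]
  exact Nat.add_le_add_right hc 1

end HasInvRepr

/-- **Determinantal complexity of inverse read-outs**: `HasInvRepr g m → dc g ≤ m + 1`
(BCS 1997, Thm. (21.27): expression size `u` gives a determinant of size `2u + 2`; here the size
bookkeeping is by the number of vertices of the branching program).
[cite: BurgisserClausenShokrollahi1997, Thm. (21.27), p. 553] -/
theorem determinantalComplexity_le_succ_of_hasInvRepr {g : MvPolynomial σ k} {m : ℕ}
    (h : HasInvRepr g m) : determinantalComplexity g ≤ m + 1 :=
  determinantalComplexity_le_of_hasDetRepr h.hasDetRepr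

end InvRepr


/-! ## Part 2. The stage recursion (BCS 1997, Thm. (21.36), proof (F)–(H)) -/

/-! ### Sums and products of lists of inverse read-outs -/

section Lists

variable {k : Type u} [CommRing k] {σ : Type v}

/-- Sum of a list: sizes add (iterated `HasInvRepr.add`, starting from the empty representation
of `0`). [cite: BurgisserClausenShokrollahi1997, Lemma (21.28), p. 554] -/
theorem HasInvRepr.list_sum {L : List (MvPolynomial σ k)} {b : ℕ}
    (h : ∀ p ∈ L, HasInvRepr p b) : HasInvRepr L.sum (L.length * b) := by
  induction L with
  | nil => simpa using HasInvRepr.zero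
  | cons p L ih =>
    rw [List.sum_cons, List.length_cons, Nat.succ_mul, Nat.add_comm]
    exact (h p (by simp)).add (ih fun q hq => h q (by simp [hq]))

/-- Sum over a `Finset`: sizes add.
[cite: BurgisserClausenShokrollahi1997, Lemma (21.28), p. 554] -/
theorem HasInvRepr.finset_sum {α : Type*} (s : Finset α) {f : α → MvPolynomial σ k} {b : ℕ}
    (h : ∀ a ∈ s, HasInvRepr (f a) b) : HasInvRepr (∑ a ∈ s, f a) (s.card * b) := by
  induction s using Finset.cons_induction with
  | empty => simpa using HasInvRepr.zero
  | cons a s ha ih =>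
    rw [Finset.sum_cons, Finset.card_cons, Nat.succ_mul, Nat.add_comm]
    exact (h a (by simp)).add (ih fun q hq => h q (by simp [hq]))

/-- Product of a list: sizes add, plus `2` for the empty product `1 = C 1`
(iterated `HasInvRepr.mul`).
[cite: BurgisserClausenShokrollahi1997, Thm. (21.27) (proof, Case 2), p. 555] -/
theorem HasInvRepr.list_prod {T : List (MvPolynomial σ k)} {b : ℕ}
    (h : ∀ p ∈ T, HasInvRepr p b) : HasInvRepr T.prod (T.length * b + 2) := by
  induction T with
  | nil =>
    simpa using HasInvRepr.of_totalDegree_le_one (a := (1 : MvPolynomial σ k)) (by simp)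
  | cons p T ih =>
    rw [List.prod_cons, List.length_cons, Nat.succ_mul, Nat.add_comm (T.length * b) b,
      Nat.add_assoc]
    exact (h p (by simp)).mul (ih fun q hq => h q (by simp [hq]))

end Lists

/-! ### The size recursion along the stages -/

/-- The size bound of stage `j` (atoms of formal degree `≤ 2^j`) over `N = #ι²` summands per
expansion: `b₀ = 2` (affine atoms), `b_{j+1} = N · (5 b_j + 2)` (at most `N` products of at most
`5` atoms of the previous stages; BCS 1997, proof of Thm. (21.36), (F)–(H): `r` summands of `3`
factors per stage).
[cite: BurgisserClausenShokrollahi1997, Thm. (21.36) (proof, (F)–(H)), pp. 567–568] -/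
def invReprBound (N : ℕ) : ℕ → ℕ
  | 0 => 2
  | j + 1 => N * (5 * invReprBound N j + 2)

/-- `invReprBound` is monotone in `N`. [folklore] -/
theorem invReprBound_mono_left {N N' : ℕ} (h : N ≤ N') : ∀ j, invReprBound N j ≤ invReprBound N' j
  | 0 => le_rfl
  | j + 1 => Nat.mul_le_mul h (by have := invReprBound_mono_left h j; omega)

/-- `2 ≤ invReprBound N j` as soon as `1 ≤ N`. [folklore] -/
theorem two_le_invReprBound {N : ℕ} (hN : 1 ≤ N) : ∀ j, 2 ≤ invReprBound N j
  | 0 => le_rfl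
  | j + 1 => by
    have := two_le_invReprBound hN j
    calc 2 ≤ 1 * (5 * 2 + 2) := by norm_num
      _ ≤ N * (5 * invReprBound N j + 2) := Nat.mul_le_mul hN (by omega)

/-- Closed form: `invReprBound (2^F) j ≤ 2^{(F + 4) j + 1}` (since `5b + 2 ≤ 8b` for `b ≥ 1`).
[folklore] -/
theorem invReprBound_two_pow_le (F : ℕ) : ∀ j, invReprBound (2 ^ F) j ≤ 2 ^ ((F + 4) * j + 1)
  | 0 => by simp [invReprBound]
  | j + 1 => by
    have ih := invReprBound_two_pow_le F j
    have h2 := two_le_invReprBound (Nat.one_le_two_pow (n := F)) j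
    calc invReprBound (2 ^ F) (j + 1) = 2 ^ F * (5 * invReprBound (2 ^ F) j + 2) := rfl
      _ ≤ 2 ^ F * (2 ^ 3 * 2 ^ ((F + 4) * j + 1)) := by
          refine Nat.mul_le_mul_left _ ?_
          calc 5 * invReprBound (2 ^ F) j + 2 ≤ 8 * invReprBound (2 ^ F) j := by omega
            _ ≤ 2 ^ 3 * 2 ^ ((F + 4) * j + 1) := Nat.mul_le_mul (by norm_num) ih
      _ ≤ 2 ^ ((F + 4) * (j + 1) + 1) := by
          rw [← pow_add, ← pow_add]
          refine Nat.pow_le_pow_right (by norm_num) ?_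
          rw [Nat.mul_succ]
          omega

namespace DepthReduction

namespace HomCircuit

variable {k : Type u} [CommRing k] {σ : Type v} {ι : Type w} [Fintype ι] [DecidableEq ι]
variable (H : HomCircuit k σ ι)

/-- **The stage recursion** (BCS 1997, proof of Thm. (21.36), (F)–(H), composed with the
matrices of Thm. (21.27)): every atom — node value `[ν]` or gate quotient `[ν : μ]` — of formal
degree `≤ 2^j` of a homogeneous circuit certificate on `ι` has an inverse read-out of size
`≤ invReprBound (#ι²) j`. Stage `0`: atoms of formal degree `≤ 1` have affine values
(`totalDegree_aval_le`, `HasInvRepr.of_totalDegree_le_one`). Stage `j + 1`: an atom of formal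
degree `≥ 2` is the sum of the `≤ #ι²` terms of `expandAtom`, each a product of `≤ 5` atoms of
formal degree `≤ 2^j` (`expandAtom_sum`, `expandAtom_half`, `expandAtom_length_le`,
`length_expandAtom_le`), so `HasInvRepr.list_prod` / `HasInvRepr.list_sum` apply.
[cite: BurgisserClausenShokrollahi1997, Thm. (21.36) (proof, (F)–(H)), pp. 567–568] -/
theorem hasInvRepr_aval : ∀ (j : ℕ) (a : Atom ι), H.adeg a ≤ 2 ^ j →
    HasInvRepr (H.aval a) (invReprBound (Fintype.card ι * Fintype.card ι) j) := by
  intro j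
  induction j with
  | zero =>
    intro a ha
    exact HasInvRepr.of_totalDegree_le_one ((H.totalDegree_aval_le a).trans (by simpa using ha))
  | succ j ih =>
    intro a ha
    have hN : 1 ≤ Fintype.card ι * Fintype.card ι := by
      have hne : Nonempty ι := by
        cases a with
        | node ν => exact ⟨ν⟩
        | quot ν μ => exact ⟨ν⟩
      have := Fintype.card_pos_iff.2 hne
      exact Nat.one_le_iff_ne_zero.2 (Nat.mul_ne_zero (by omega) (by omega))
    by_cases h2 : 2 ≤ H.adeg a
    · -- expand: sum of ≤ N products of ≤ 5 atoms of formal degree ≤ 2^j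
      rw [← H.expandAtom_sum h2]
      have hterm : ∀ T ∈ H.expandAtom a, HasInvRepr (H.tval T)
          (5 * invReprBound (Fintype.card ι * Fintype.card ι) j + 2) := by
        intro T hT
        have hfac : ∀ p ∈ T.map H.aval,
            HasInvRepr p (invReprBound (Fintype.card ι * Fintype.card ι) j) := by
          intro p hp
          obtain ⟨b, hb, rfl⟩ := List.mem_map.1 hp
          refine ih b ?_
          have := H.expandAtom_half hT b hb
          rw [pow_succ] at ha
          omega
        have := HasInvRepr.list_prod hfac
        rw [List.length_map] at this
        exact this.mono (by
          have := H.expandAtom_length_le hT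
          exact Nat.add_le_add_right (Nat.mul_le_mul_right _ this) 2)
      have hsum : ∀ p ∈ (H.expandAtom a).map H.tval, HasInvRepr p
          (5 * invReprBound (Fintype.card ι * Fintype.card ι) j + 2) := by
        intro p hp
        obtain ⟨T, hT, rfl⟩ := List.mem_map.1 hp
        exact hterm T hT
      have := HasInvRepr.list_sum hsum
      rw [List.length_map] at this
      exact this.mono (Nat.mul_le_mul_right _ (H.length_expandAtom_le a))
    · -- affine atom
      refine (HasInvRepr.of_totalDegree_le_one
        ((H.totalDegree_aval_le a).trans (by omega))).mono ?_
      exact two_le_invReprBound hN (j + 1)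

end HomCircuit

namespace SLP

variable {k : Type u} [CommRing k] {σ : Type v} (P : SLP k σ) (d : ℕ)

/-- **Values of straight-line programs** (BCS 1997, Lemma (21.25) with Thm. (21.36)): a value
`f` of total degree `≤ d` of a straight-line program of length `L` is the sum of its homogeneous
components of degrees `0, …, d`, which are node values of the homogenized certificate
`P.homogenize d` on `≤ S = 4L(d+1)²` nodes, of formal degree `≤ d < 2^{log₂ d + 1}`; hence
`HasInvRepr f ((d + 1) · invReprBound (S²) (log₂ d + 1))`.
[cite: BurgisserClausenShokrollahi1997, Lemma (21.25) and Thm. (21.36), pp. 551, 565] -/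
theorem hasInvRepr_val {i : ℕ} (hi : i < P.len) (hd : (P.val i).totalDegree ≤ d) :
    HasInvRepr (P.val i) ((d + 1) *
      invReprBound ((4 * P.len * (d + 1) ^ 2) * (4 * P.len * (d + 1) ^ 2)) (Nat.log 2 d + 1)) := by
  classical
  rw [← sum_homogeneousComponent_of_le hd]
  have hcomp : ∀ e ∈ Finset.range (d + 1), HasInvRepr (homogeneousComponent e (P.val i))
      (invReprBound ((4 * P.len * (d + 1) ^ 2) * (4 * P.len * (d + 1) ^ 2))
        (Nat.log 2 d + 1)) := by
    intro e he
    have he' : e < d + 1 := Finset.mem_range.1 he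
    have hval : (P.homogenize d).aval (.node (⟨i, hi⟩, Tag.Q ⟨e, he'⟩)) =
        homogeneousComponent e (P.val i) := rfl
    rw [← hval]
    refine ((P.homogenize d).hasInvRepr_aval (Nat.log 2 d + 1) _ ?_).mono
      (invReprBound_mono_left (Nat.mul_le_mul (P.card_node_le d) (P.card_node_le d)) _)
    show e ≤ 2 ^ (Nat.log 2 d + 1)
    exact (Nat.lt_succ_iff.1 he').trans (Nat.lt_pow_succ_log_self Nat.one_lt_two d).le
  have := HasInvRepr.finset_sum (Finset.range (d + 1)) hcomp
  rwa [Finset.card_range] at this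

end SLP

end DepthReduction

/-! ## Part 3. The quasi-polynomial bound (BCS 1997, Def. (21.31), Cor. (21.40)) -/

/-! ### Arithmetic -/

section Arithmetic

/-- A p-bounded function is `< 2^{(log₂ n + 1) A}` for a constant `A ≥ 1` (from
`n < 2^{log₂ n + 1}`). [folklore] -/
theorem IsPBounded.exists_lt_two_pow {t : ℕ → ℕ} (ht : IsPBounded t) :
    ∃ A : ℕ, 1 ≤ A ∧ ∀ n, t n < 2 ^ ((Nat.log 2 n + 1) * A) := by
  obtain ⟨a, ha⟩ := ht
  refine ⟨2 * a + 2, by omega, fun n => (ha n).trans_lt ?_⟩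
  set l := Nat.log 2 n + 1 with hl
  have hn : n < 2 ^ l := Nat.lt_pow_succ_log_self Nat.one_lt_two n
  have h1 : n ^ a ≤ 2 ^ (l * a) := by
    rw [pow_mul]
    exact Nat.pow_le_pow_left hn.le a
  have h2 : a + 1 ≤ 2 ^ (a + 1) := Nat.lt_two_pow_self.le
  have h3 : 1 ≤ 2 ^ (l * a) := Nat.one_le_two_pow
  have h4 : a ≤ l * a := Nat.le_mul_of_pos_left a (by omega)
  have h5 : l * a + (a + 1) + 1 ≤ l * (2 * a + 2) := by
    have : l * (2 * a + 2) = 2 * (l * a) + 2 * l := by ring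
    rw [this]
    omega
  calc n ^ a + a < 2 ^ (l * a) + 2 ^ (l * a) * (a + 1) := by nlinarith
    _ ≤ 2 ^ (l * a) * 2 ^ (a + 1) + 2 ^ (l * a) * 2 ^ (a + 1) := by nlinarith
    _ = 2 ^ (l * a + (a + 1) + 1) := by rw [pow_add, pow_add]; ring
    _ ≤ 2 ^ (l * (2 * a + 2)) := Nat.pow_le_pow_right (by norm_num) h5

/-- The main estimate: if `d < 2^E`, `L ≤ 2^E` and `1 ≤ E`, then
`(d + 1) · invReprBound ((4L(d+1)²)²) (log₂ d + 1) + 1 ≤ 2^{17 E²}`. [folklore] -/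
theorem succ_mul_invReprBound_le {d L E : ℕ} (hd : d < 2 ^ E) (hL : L ≤ 2 ^ E) (hE : 1 ≤ E) :
    (d + 1) * invReprBound ((4 * L * (d + 1) ^ 2) * (4 * L * (d + 1) ^ 2)) (Nat.log 2 d + 1) + 1 ≤
      2 ^ (17 * E ^ 2) := by
  -- S = 4 L (d+1)² ≤ 2^{3E+2}, S² ≤ 2^{6E+4}
  have hd1 : d + 1 ≤ 2 ^ E := hd
  have hS : 4 * L * (d + 1) ^ 2 ≤ 2 ^ (3 * E + 2) := by
    calc 4 * L * (d + 1) ^ 2 ≤ 4 * 2 ^ E * (2 ^ E) ^ 2 :=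
          Nat.mul_le_mul (Nat.mul_le_mul_left 4 hL) (Nat.pow_le_pow_left hd1 2)
      _ = 2 ^ (3 * E + 2) := by rw [← pow_mul, pow_add, pow_mul]; ring
  have hSS : (4 * L * (d + 1) ^ 2) * (4 * L * (d + 1) ^ 2) ≤ 2 ^ (6 * E + 4) := by
    calc (4 * L * (d + 1) ^ 2) * (4 * L * (d + 1) ^ 2) ≤ 2 ^ (3 * E + 2) * 2 ^ (3 * E + 2) :=
          Nat.mul_le_mul hS hS
      _ = 2 ^ (6 * E + 4) := by rw [← pow_add]; ring_nf
  -- log₂ d + 1 ≤ E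
  have hlog : Nat.log 2 d + 1 ≤ E := by
    rcases Nat.eq_zero_or_pos d with rfl | hdpos
    · simpa using hE
    · exact Nat.succ_le_of_lt ((Nat.log_lt_iff_lt_pow Nat.one_lt_two hdpos.ne').2 hd)
  -- the stage bound
  have hB : invReprBound ((4 * L * (d + 1) ^ 2) * (4 * L * (d + 1) ^ 2)) (Nat.log 2 d + 1) ≤
      2 ^ ((6 * E + 8) * E + 1) := by
    refine (invReprBound_mono_left hSS _).trans ((invReprBound_two_pow_le _ _).trans ?_)
    refine Nat.pow_le_pow_right (by norm_num) ?_
    have : (6 * E + 4 + 4) * (Nat.log 2 d + 1) ≤ (6 * E + 8) * E :=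
      (Nat.mul_le_mul_left _ hlog).trans (by ring_nf; exact le_rfl)
    omega
  -- assemble
  have h1 : (d + 1) * invReprBound ((4 * L * (d + 1) ^ 2) * (4 * L * (d + 1) ^ 2))
      (Nat.log 2 d + 1) ≤ 2 ^ (E + ((6 * E + 8) * E + 1)) := by
    rw [pow_add]
    exact Nat.mul_le_mul hd1 hB
  have h2 : 1 ≤ 2 ^ (E + ((6 * E + 8) * E + 1)) := Nat.one_le_two_pow
  calc (d + 1) * invReprBound ((4 * L * (d + 1) ^ 2) * (4 * L * (d + 1) ^ 2))
        (Nat.log 2 d + 1) + 1 ≤ 2 ^ (E + ((6 * E + 8) * E + 1)) * 2 := by omega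
    _ = 2 ^ (E + ((6 * E + 8) * E + 1) + 1) := by rw [pow_succ]
    _ ≤ 2 ^ (17 * E ^ 2) := Nat.pow_le_pow_right (by norm_num) (by nlinarith)

/-- The exponent bookkeeping: `17 A² (ℓ + 1)² ≤ (ℓ + c)^c` for `c = 17 A² + 3`. [folklore] -/
theorem exponent_le_pow (A ℓ : ℕ) :
    17 * ((ℓ + 1) * A) ^ 2 ≤ (ℓ + (17 * A ^ 2 + 3)) ^ (17 * A ^ 2 + 3) := by
  set c := 17 * A ^ 2 + 3 with hc
  have hc3 : 3 ≤ c := by omega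
  have hx : 1 ≤ ℓ + c := by omega
  calc 17 * ((ℓ + 1) * A) ^ 2 = 17 * A ^ 2 * (ℓ + 1) ^ 2 := by ring
    _ ≤ c * (ℓ + c) ^ 2 := Nat.mul_le_mul (by omega) (Nat.pow_le_pow_left (by omega) 2)
    _ ≤ (ℓ + c) * (ℓ + c) ^ 2 := Nat.mul_le_mul_right _ (by omega)
    _ = (ℓ + c) ^ 3 := by ring
    _ ≤ (ℓ + c) ^ c := Nat.pow_le_pow_right hx hc3

end Arithmetic

/-! ### The discharge -/

section Discharge

variable {k : Type u} [CommRing k] {σ : Type v}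

/-- **Determinantal complexity of a single polynomial from its circuit complexity and degree**
(BCS 1997, Thm. (21.36) with Thm. (21.27), in the present bookkeeping): if `deg g ≤ d < 2^E`
and `L(g) ≤ 2^E` (`complexity`, fan-in two gate count), `1 ≤ E`, then `dc g ≤ 2^{17 E²}`.
Via `ArithCircuit.exists_computes_size_eq_complexity`, `DepthReduction.exists_slp`,
`SLP.hasInvRepr_val`, `determinantalComplexity_le_succ_of_hasInvRepr`; the gate-free outputs
(a variable or a constant) are affine, of determinantal complexity `≤ 3`.
[cite: BurgisserClausenShokrollahi1997, Thm. (21.36) and Thm. (21.27), pp. 553, 565] -/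
theorem determinantalComplexity_le_two_pow {g : MvPolynomial σ k} {d E : ℕ}
    (hdeg : g.totalDegree ≤ d) (hd : d < 2 ^ E) (hL : complexity g ≤ 2 ^ E) (hE : 1 ≤ E) :
    determinantalComplexity g ≤ 2 ^ (17 * E ^ 2) := by
  classical
  obtain ⟨P, hfan, hcomp, hsize⟩ := ArithCircuit.exists_computes_size_eq_complexity g
  obtain ⟨S, hlen, hcases⟩ := DepthReduction.exists_slp P hfan
  rw [show P.eval = g from hcomp] at hcases
  have h3 : 3 ≤ 2 ^ (17 * E ^ 2) := by
    calc 3 ≤ 2 ^ 2 := by norm_num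
      _ ≤ 2 ^ (17 * E ^ 2) := Nat.pow_le_pow_right (by norm_num) (by nlinarith)
  have haff : ∀ a : MvPolynomial σ k, a.totalDegree ≤ 1 → determinantalComplexity a ≤ 3 :=
    fun a ha => determinantalComplexity_le_succ_of_hasInvRepr
      (HasInvRepr.of_totalDegree_le_one ha)
  rcases hcases with ⟨i, hi, hgi⟩ | ⟨j, hgj⟩ | ⟨c, hgc⟩
  · have hdi : (S.val i).totalDegree ≤ d := by rw [← hgi]; exact hdeg
    have hrepr := DepthReduction.SLP.hasInvRepr_val S d hi hdi
    rw [← hgi] at hrepr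
    have hSlen : S.len ≤ 2 ^ E := by rw [hlen, hsize]; exact hL
    exact (determinantalComplexity_le_succ_of_hasInvRepr hrepr).trans
      (succ_mul_invReprBound_le hd hSlen hE)
  · rw [hgj]
    exact (haff _ (by simpa using (isHomogeneous_X k j).totalDegree_le)).trans h3
  · rw [hgc]
    exact (haff _ (by simp)).trans h3

end Discharge

/-- **Discharge of `isQPBounded_determinantalComplexity_of_isVPFamily`** (Bürgisser–Clausen–
Shokrollahi 1997, Cor. (21.40) with Thm. (21.27), Thm. (21.33), Thm. (21.36); Valiant 1979,
Valiant–Skyum–Berkowitz–Rackoff 1983): for every field `k` and every `VP` family `f`, the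
determinantal complexity `dc(fₙ)` is quasi-polynomially bounded, `dc(fₙ) ≤ 2^{(log₂ n + c)^c}`.
With `deg fₙ, L(fₙ) < 2^{(log₂ n + 1)A}` (`IsPBounded.exists_lt_two_pow`) the single-polynomial
bound `determinantalComplexity_le_two_pow` gives `dc(fₙ) ≤ 2^{17A²(log₂ n + 1)²}`, and
`17A²(ℓ+1)² ≤ (ℓ + c)^c` for `c = 17A² + 3` (`exponent_le_pow`).
[cite: BurgisserClausenShokrollahi1997, Cor. (21.40), Thm. (21.27), Thm. (21.36), pp. 553–569] -/
theorem isQPBounded_determinantalComplexity_of_isVPFamily_holds :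
    isQPBounded_determinantalComplexity_of_isVPFamily := by
  intro k _ σ _ f hf
  obtain ⟨⟨-, hdegp⟩, hLp⟩ := hf
  obtain ⟨A₁, hA₁, hdeg⟩ := IsPBounded.exists_lt_two_pow hdegp
  obtain ⟨A₂, -, hL⟩ := IsPBounded.exists_lt_two_pow hLp
  set A := A₁ + A₂ with hA
  refine ⟨17 * A ^ 2 + 3, fun n => ?_⟩
  set E := (Nat.log 2 n + 1) * A with hE
  have hE1 : 1 ≤ E := Nat.one_le_iff_ne_zero.2 (Nat.mul_ne_zero (by omega) (by omega))
  have hEd : (Nat.log 2 n + 1) * A₁ ≤ E := Nat.mul_le_mul_left _ (by omega)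
  have hEL : (Nat.log 2 n + 1) * A₂ ≤ E := Nat.mul_le_mul_left _ (by omega)
  have hd : (f n).totalDegree < 2 ^ E :=
    (hdeg n).trans_le (Nat.pow_le_pow_right (by norm_num) hEd)
  have hc : complexity (f n) ≤ 2 ^ E :=
    ((hL n).trans_le (Nat.pow_le_pow_right (by norm_num) hEL)).le
  calc determinantalComplexity (f n) ≤ 2 ^ (17 * E ^ 2) :=
        determinantalComplexity_le_two_pow le_rfl hd hc hE1
    _ ≤ 2 ^ ((Nat.log 2 n + (17 * A ^ 2 + 3)) ^ (17 * A ^ 2 + 3)) :=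
        Nat.pow_le_pow_right (by norm_num) (exponent_le_pow A (Nat.log 2 n))

end Literature.Computability.AlgebraicComplexity
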